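import Summits.NavierStokesRegularity.NavierStokesRegularity.Theorems.HubbleDynamoHelicityFluxIdentityBalance
import HarnessLib

/-!
# The helicity-flux identity of a Leray profile, II: the cut-off layer and the decay class
# (route `HubbleDynamo`, item `HelicityFluxIdentity`, stmt-NavierStokesRegularity-2060)

Helper file (all results proved; no definitions, no named facts): the analysis shared by the steady
identity (`HubbleDynamoHelicityFluxIdentity`) and its `s`-periodic companion. With the tree's cut-off
family `cutoff R` (`= 1` on `|y| ≤ R`, `= 0` off `|y| ≤ 2R`, `‖∇cutoff R‖ ≤ K₀/R`):

* `hubbleHelicity_fderiv_cutoff_eq_zero_of_lt/gt`, `hubbleHelicity_weight_le` — the gradient lives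
  on the layer `R ≤ |y| ≤ 2R`, where `(1+|y|)‖∇cutoff R‖ ≤ 3K₀` for `R ≥ 1`: one power of `|y|` to
  spend on the flux terms;
* `hubbleHelicity_tendsto_integral_cutoff_mul` — `∫ cutoff R · S → ∫ S` for `S ∈ L¹`;
* `hubbleHelicity_flux_error_pointwise/bound/tendsto` — for a continuous field `G = O((1+|y|)⁻³)`
  the flux term `∫ ∇cutoff R·G` is dominated by `3K₀ K (1+|y|)⁻⁴ ∈ L¹` uniformly in `R ≥ 1` and
  tends to `0`;
* `hubbleHelicity_decay_bounds` — in the Type-I decay class `|U| ≤ C/(1+|y|)`,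
  `|∇U| ≤ C/(1+|y|)²`, `|∇curl U| ≤ C/(1+|y|)³`, `|P| ≤ C/(1+|y|)`: the Ohmic density
  `⟪Ω, curl Ω⟫` is `O((1+|y|)⁻⁵)` and the three flux fields `(½|U|²−P)Ω`, `⟪U,Ω⟫U`, `(curl Ω)×U`
  are `O((1+|y|)⁻³)`, with constants explicit in `C` and `κ = ‖curlCLM‖`.

References: as in part I.
-/

noncomputable section

-- D-0017: `<Problem> = <Summit>` by design; the lakefile turns this linter off for `Summits`.
set_option linter.dupNamespace false

open MeasureTheory Set Function Filter Topology InnerProductSpace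
open scoped RealInnerProductSpace Laplacian ContDiff

namespace Summit.NavierStokesRegularity.NavierStokesRegularity.Theorems

open Literature.Analysis.FluidPDE

/-! ### The cut-off layer -/

/-- Inside the ball of radius `R` the cut-off `cutoff R` is identically `1`, so its derivative
vanishes there. -/
theorem hubbleHelicity_fderiv_cutoff_eq_zero_of_lt {R : ℝ} (hR : 0 < R)
    {y : EuclideanSpace ℝ (Fin 3)} (hy : ‖y‖ < R) :
    fderiv ℝ (cutoff (E := EuclideanSpace ℝ (Fin 3)) R) y = 0 := by
  have hev : (cutoff (E := EuclideanSpace ℝ (Fin 3)) R) =ᶠ[𝓝 y] fun _ => (1 : ℝ) := by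
    have ho : IsOpen {x : EuclideanSpace ℝ (Fin 3) | ‖x‖ < R} :=
      isOpen_lt continuous_norm continuous_const
    filter_upwards [ho.mem_nhds hy] with x hx
    exact cutoff_eq_one hR (le_of_lt hx)
  rw [hev.fderiv_eq]
  simp

/-- Off the ball of radius `2R` the cut-off vanishes identically, so its derivative vanishes. -/
theorem hubbleHelicity_fderiv_cutoff_eq_zero_of_gt {R : ℝ} (hR : 0 < R)
    {y : EuclideanSpace ℝ (Fin 3)} (hy : 2 * R < ‖y‖) :
    fderiv ℝ (cutoff (E := EuclideanSpace ℝ (Fin 3)) R) y = 0 := by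
  have hev : (cutoff (E := EuclideanSpace ℝ (Fin 3)) R) =ᶠ[𝓝 y] fun _ => (0 : ℝ) := by
    have ho : IsOpen {x : EuclideanSpace ℝ (Fin 3) | 2 * R < ‖x‖} :=
      isOpen_lt continuous_const continuous_norm
    filter_upwards [ho.mem_nhds hy] with x hx
    exact cutoff_eq_zero hR (le_of_lt hx)
  rw [hev.fderiv_eq]
  simp

/-- **The weight of the flux terms.** If `‖∇cutoff R‖ ≤ K/R` then, for `R ≥ 1`,
`(1 + |y|) ‖∇cutoff R (y)‖ ≤ 3K`: the gradient lives on the layer `R ≤ |y| ≤ 2R`, where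
`1 + |y| ≤ 1 + 2R ≤ 3R`. This is the one power of `|y|` the flux terms may spend. -/
theorem hubbleHelicity_weight_le {K R : ℝ} (hR : 1 ≤ R)
    (hK : ∀ x : EuclideanSpace ℝ (Fin 3), ‖fderiv ℝ (cutoff R) x‖ ≤ K / R)
    (y : EuclideanSpace ℝ (Fin 3)) :
    (1 + ‖y‖) * ‖fderiv ℝ (cutoff (E := EuclideanSpace ℝ (Fin 3)) R) y‖ ≤ 3 * K := by
  have hR0 : 0 < R := by linarith
  have hK0 : 0 ≤ K := by
    have h0 := (norm_nonneg _).trans (hK 0)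
    exact (div_nonneg_iff.1 h0).elim (fun h => h.1) fun h => absurd h.2 (not_le.2 hR0)
  by_cases hy : ‖y‖ ≤ 2 * R
  · calc (1 + ‖y‖) * ‖fderiv ℝ (cutoff R) y‖ ≤ (1 + 2 * R) * (K / R) :=
          mul_le_mul (by linarith) (hK y) (norm_nonneg _) (by positivity)
      _ = K / R + 2 * K := by
          field_simp
      _ ≤ K + 2 * K := by
          gcongr
          exact div_le_self hK0 hR
      _ = 3 * K := by ring
  · rw [hubbleHelicity_fderiv_cutoff_eq_zero_of_gt hR0 (not_le.1 hy), norm_zero, mul_zero]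
    positivity

/-! ### The limit `R → ∞` -/

/-- **The helicity inside the cut-off.** For an integrable density `S`, `∫ cutoff R · S → ∫ S` as
`R → ∞` (dominated convergence: `|cutoff R| ≤ 1`, `cutoff R → 1` pointwise). -/
theorem hubbleHelicity_tendsto_integral_cutoff_mul {S : EuclideanSpace ℝ (Fin 3) → ℝ}
    (hS : Integrable S) :
    Tendsto (fun R : ℝ => ∫ y, cutoff R y * S y) atTop (𝓝 (∫ y, S y)) := by
  refine tendsto_integral_filter_of_dominated_convergence (fun y => ‖S y‖) ?_ ?_ hS.norm ?_
  · exact Eventually.of_forall fun R =>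
      (contDiff_cutoff (n := 1) R).continuous.aestronglyMeasurable.mul hS.aestronglyMeasurable
  · refine Eventually.of_forall fun R => Eventually.of_forall fun y => ?_
    rw [norm_mul]
    refine mul_le_of_le_one_left (norm_nonneg _) ?_
    rw [Real.norm_eq_abs]
    exact abs_cutoff_le_one R y
  · refine Eventually.of_forall fun y => ?_
    refine (tendsto_const_nhds (x := S y)).congr' ?_
    filter_upwards [eventually_cutoff_eq_one y] with R hR
    rw [hR, one_mul]

/-- **Pointwise domination of the flux terms.** If `‖∇cutoff R‖ ≤ K₀/R` (`R > 0`) and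
`‖G y‖ ≤ K (1+|y|)⁻³`, then for `R ≥ 1` the flux integrand is dominated by an `R`-independent
integrable function: `‖∇cutoff R (y)·G(y)‖ ≤ 3K₀ · K (1+|y|)⁻⁴`. -/
theorem hubbleHelicity_flux_error_pointwise {K₀ : ℝ}
    (hK₀ : ∀ R : ℝ, 0 < R → ∀ x : EuclideanSpace ℝ (Fin 3), ‖fderiv ℝ (cutoff R) x‖ ≤ K₀ / R)
    {G : EuclideanSpace ℝ (Fin 3) → EuclideanSpace ℝ (Fin 3)} {K : ℝ}
    (hle : ∀ y, ‖G y‖ ≤ K * ((1 + ‖y‖) ^ 3)⁻¹) {R : ℝ} (hR : 1 ≤ R)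
    (y : EuclideanSpace ℝ (Fin 3)) :
    ‖fderiv ℝ (cutoff R) y (G y)‖ ≤ 3 * K₀ * (K * ((1 + ‖y‖) ^ 4)⁻¹) := by
  have hr0 : 0 < 1 + ‖y‖ := by positivity
  have hw := hubbleHelicity_weight_le hR (hK₀ R (by linarith)) y
  have hK₀0 : 0 ≤ 3 * K₀ := by
    have := (mul_nonneg hr0.le (norm_nonneg _)).trans hw
    linarith
  calc ‖fderiv ℝ (cutoff R) y (G y)‖ ≤ ‖fderiv ℝ (cutoff R) y‖ * ‖G y‖ :=
        ContinuousLinearMap.le_opNorm _ _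
    _ = ((1 + ‖y‖) * ‖fderiv ℝ (cutoff R) y‖) * ((1 + ‖y‖)⁻¹ * ‖G y‖) := by
        field_simp
    _ ≤ 3 * K₀ * ((1 + ‖y‖)⁻¹ * (K * ((1 + ‖y‖) ^ 3)⁻¹)) :=
        mul_le_mul hw (mul_le_mul_of_nonneg_left (hle y) (inv_nonneg.2 hr0.le))
          (mul_nonneg (inv_nonneg.2 hr0.le) (norm_nonneg _)) hK₀0
    _ = 3 * K₀ * (K * ((1 + ‖y‖) ^ 4)⁻¹) := by
        have e4 : ((1 + ‖y‖) ^ 4)⁻¹ = (1 + ‖y‖)⁻¹ * ((1 + ‖y‖) ^ 3)⁻¹ := by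
          rw [← mul_inv, ← pow_succ']
        rw [e4]
        ring

/-- The decay profile `(1+|y|)⁻⁴` is integrable on `ℝ³`. -/
theorem hubbleHelicity_integrable_decay_four :
    Integrable fun y : EuclideanSpace ℝ (Fin 3) => ((1 + ‖y‖) ^ 4)⁻¹ := by
  have hc : Continuous fun y : EuclideanSpace ℝ (Fin 3) => ((1 + ‖y‖) ^ 4)⁻¹ :=
    ((continuous_const.add continuous_norm).pow 4).inv₀ fun y =>
      pow_ne_zero 4 (add_pos_of_pos_of_nonneg one_pos (norm_nonneg y)).ne'
  refine hubbleDilution_integrable_of_le (K := 1) (k := 4) hc le_rfl fun y => ?_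
  rw [Real.norm_eq_abs, abs_of_nonneg (inv_nonneg.2 (pow_nonneg
    (add_pos_of_pos_of_nonneg one_pos (norm_nonneg y)).le 4)), one_mul]

/-- **Uniform bound on the flux terms.** Under the hypotheses of
`hubbleHelicity_flux_error_pointwise`, for every `R ≥ 1`,
`‖∫ ∇cutoff R · G‖ ≤ 3K₀ K ∫ (1+|y|)⁻⁴` — a bound independent of `R` (and, for a family of fields
with a common decay constant `K`, of the field). -/
theorem hubbleHelicity_flux_error_bound {K₀ : ℝ}
    (hK₀ : ∀ R : ℝ, 0 < R → ∀ x : EuclideanSpace ℝ (Fin 3), ‖fderiv ℝ (cutoff R) x‖ ≤ K₀ / R)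
    {G : EuclideanSpace ℝ (Fin 3) → EuclideanSpace ℝ (Fin 3)} {K : ℝ}
    (hle : ∀ y, ‖G y‖ ≤ K * ((1 + ‖y‖) ^ 3)⁻¹) {R : ℝ} (hR : 1 ≤ R) :
    ‖∫ y, fderiv ℝ (cutoff R) y (G y)‖ ≤
      3 * K₀ * (K * ∫ y : EuclideanSpace ℝ (Fin 3), ((1 + ‖y‖) ^ 4)⁻¹) := by
  rw [← integral_const_mul, ← integral_const_mul]
  refine (norm_integral_le_integral_norm _).trans (integral_mono_of_nonneg
    (Eventually.of_forall fun y => norm_nonneg _)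
    ((hubbleHelicity_integrable_decay_four.const_mul K).const_mul _)
    (Eventually.of_forall fun y => hubbleHelicity_flux_error_pointwise hK₀ hle hR y))

/-- **The flux terms vanish in the limit.** If `G` is continuous with `‖G y‖ ≤ K (1+|y|)⁻³`, then
`∫ ∇(cutoff R)·G → 0` as `R → ∞`: by `hubbleHelicity_weight_le` the integrand is dominated by
`3K₀ (1+|y|)⁻¹ ‖G y‖ = O((1+|y|)⁻⁴) ∈ L¹`, and it vanishes identically as soon as `R > |y|`. -/
theorem hubbleHelicity_flux_error_tendsto {G : EuclideanSpace ℝ (Fin 3) → EuclideanSpace ℝ (Fin 3)}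
    (hG : Continuous G) {K : ℝ} (hle : ∀ y, ‖G y‖ ≤ K * ((1 + ‖y‖) ^ 3)⁻¹) :
    Tendsto (fun R : ℝ => ∫ y, fderiv ℝ (cutoff R) y (G y)) atTop (𝓝 0) := by
  obtain ⟨K₀, hK₀0, hK₀⟩ := exists_norm_fderiv_cutoff_le (E := EuclideanSpace ℝ (Fin 3))
  have e0 : (0 : ℝ) = ∫ _ : EuclideanSpace ℝ (Fin 3), (0 : ℝ) := by simp
  rw [e0]
  refine tendsto_integral_filter_of_dominated_convergence
    (fun y => 3 * K₀ * (K * ((1 + ‖y‖) ^ 4)⁻¹)) ?_ ?_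
    ((hubbleHelicity_integrable_decay_four.const_mul K).const_mul _) ?_
  · exact Eventually.of_forall fun R =>
      (((contDiff_cutoff (n := 1) R).continuous_fderiv one_ne_zero).clm_apply hG).aestronglyMeasurable
  · filter_upwards [eventually_ge_atTop (1 : ℝ)] with R hR
    exact Eventually.of_forall fun y => hubbleHelicity_flux_error_pointwise hK₀ hle hR y
  · refine Eventually.of_forall fun y => ?_
    refine (tendsto_const_nhds (x := (0 : ℝ))).congr' ?_
    filter_upwards [eventually_gt_atTop ‖y‖, eventually_gt_atTop (0 : ℝ)] with R h1 h2
    rw [hubbleHelicity_fderiv_cutoff_eq_zero_of_lt h2 h1]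
    simp

/-- Monotonicity of the decay scale: for `t ≥ 1`, `0 ≤ K` and `n ≤ m`, `K (tᵐ)⁻¹ ≤ K (tⁿ)⁻¹`. -/
theorem hubbleHelicity_decay_mono {K t : ℝ} (hK : 0 ≤ K) (ht : 1 ≤ t) {n m : ℕ} (hnm : n ≤ m) :
    K * (t ^ m)⁻¹ ≤ K * (t ^ n)⁻¹ := by
  refine mul_le_mul_of_nonneg_left ?_ hK
  have htn : 0 < t ^ n := pow_pos (by linarith) n
  exact inv_anti₀ htn (pow_le_pow_right₀ ht hnm)

/-! ### The Type-I decay class -/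

/-- **Pointwise bounds in the decay class.** If `|U| ≤ C/(1+|y|)`, `|∇U| ≤ C/(1+|y|)²`,
`|∇ curl U| ≤ C/(1+|y|)³` and `|P| ≤ C/(1+|y|)` then, with `κ = ‖curlCLM‖` (so that
`|curl v| ≤ κ |∇v|`): `|⟪Ω, curl Ω⟫| ≤ (κC)² (1+|y|)⁻⁵` and the three flux fields satisfy
`|(½|U|²−P) Ω| ≤ (C²/2 + C) κC (1+|y|)⁻³`, `|⟪U,Ω⟫ U| ≤ κC³ (1+|y|)⁻³`,
`|(curl Ω) × U| ≤ κC² (1+|y|)⁻³` (`Ω = curl U`; no differentiability is needed, the operators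
carry their junk values consistently). -/
theorem hubbleHelicity_decay_bounds
    {U : EuclideanSpace ℝ (Fin 3) → EuclideanSpace ℝ (Fin 3)} {P : EuclideanSpace ℝ (Fin 3) → ℝ}
    {C : ℝ} (hC : ∀ y, ‖U y‖ ≤ C / (1 + ‖y‖) ∧ ‖fderiv ℝ U y‖ ≤ C / (1 + ‖y‖) ^ 2 ∧
      ‖fderiv ℝ (curl U) y‖ ≤ C / (1 + ‖y‖) ^ 3)
    (hPC : ∀ y, |P y| ≤ C / (1 + ‖y‖)) (y : EuclideanSpace ℝ (Fin 3)) :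
    ‖⟪curl U y, curl (curl U) y⟫‖ ≤ (‖curlCLM‖ * C) * (‖curlCLM‖ * C) * ((1 + ‖y‖) ^ 5)⁻¹
      ∧ ‖(‖U y‖ ^ 2 / 2 - P y) • curl U y‖ ≤ (C * C / 2 + C) * (‖curlCLM‖ * C) * ((1 + ‖y‖) ^ 3)⁻¹
      ∧ ‖⟪U y, curl U y⟫ • U y‖ ≤ C * (‖curlCLM‖ * C) * C * ((1 + ‖y‖) ^ 3)⁻¹
      ∧ ‖cross (curl (curl U) y) (U y)‖ ≤ ‖curlCLM‖ * C * C * ((1 + ‖y‖) ^ 3)⁻¹ := by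
  have hr : ∀ y : EuclideanSpace ℝ (Fin 3), 1 ≤ 1 + ‖y‖ := fun y => by linarith [norm_nonneg y]
  have hr0 : ∀ y : EuclideanSpace ℝ (Fin 3), 0 < 1 + ‖y‖ := fun y => by linarith [norm_nonneg y]
  have hC0 : 0 ≤ C := by
    have h0 := (hC 0).1
    rw [norm_zero, add_zero, div_one] at h0
    exact (norm_nonneg _).trans h0
  set κ : ℝ := ‖curlCLM‖ with hκ
  have hκ0 : 0 ≤ κ := by rw [hκ]; exact norm_nonneg curlCLM
  have bU : ∀ y, ‖U y‖ ≤ C * (1 + ‖y‖)⁻¹ := fun y => by rw [← div_eq_mul_inv]; exact (hC y).1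
  have bP : ∀ y, |P y| ≤ C * (1 + ‖y‖)⁻¹ := fun y => by rw [← div_eq_mul_inv]; exact hPC y
  have bΩ : ∀ y, ‖curl U y‖ ≤ κ * C * ((1 + ‖y‖) ^ 2)⁻¹ := fun y => by
    calc ‖curl U y‖ ≤ κ * ‖fderiv ℝ U y‖ := norm_curl_le U y
      _ ≤ κ * (C / (1 + ‖y‖) ^ 2) := mul_le_mul_of_nonneg_left (hC y).2.1 hκ0
      _ = κ * C * ((1 + ‖y‖) ^ 2)⁻¹ := by rw [div_eq_mul_inv, mul_assoc]
  have bΞ : ∀ y, ‖curl (curl U) y‖ ≤ κ * C * ((1 + ‖y‖) ^ 3)⁻¹ := fun y => by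
    calc ‖curl (curl U) y‖ ≤ κ * ‖fderiv ℝ (curl U) y‖ := norm_curl_le (curl U) y
      _ ≤ κ * (C / (1 + ‖y‖) ^ 3) := mul_le_mul_of_nonneg_left (hC y).2.2 hκ0
      _ = κ * C * ((1 + ‖y‖) ^ 3)⁻¹ := by rw [div_eq_mul_inv, mul_assoc]
  refine ⟨?_, ?_, ?_, ?_⟩
  · calc ‖⟪curl U y, curl (curl U) y⟫‖ ≤ ‖curl U y‖ * ‖curl (curl U) y‖ := norm_inner_le_norm _ _
      _ ≤ (κ * C * ((1 + ‖y‖) ^ 2)⁻¹) * (κ * C * ((1 + ‖y‖) ^ 3)⁻¹) :=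
          mul_le_mul (bΩ y) (bΞ y) (norm_nonneg _) (by positivity)
      _ = (κ * C) * (κ * C) * ((1 + ‖y‖) ^ 5)⁻¹ := by
          field_simp [(hr0 y).ne']
  · have hq : |‖U y‖ ^ 2 / 2 - P y| ≤ (C * C / 2 + C) * (1 + ‖y‖)⁻¹ := by
      have h1 : ‖U y‖ ^ 2 ≤ (C * (1 + ‖y‖)⁻¹) ^ 2 := pow_le_pow_left₀ (norm_nonneg _) (bU y) 2
      have h2 : (C * (1 + ‖y‖)⁻¹) ^ 2 ≤ C * C * (1 + ‖y‖)⁻¹ := by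
        rw [mul_pow, sq, sq]
        refine mul_le_mul_of_nonneg_left ?_ (mul_nonneg hC0 hC0)
        calc (1 + ‖y‖)⁻¹ * (1 + ‖y‖)⁻¹ ≤ (1 + ‖y‖)⁻¹ * 1 :=
              mul_le_mul_of_nonneg_left (inv_le_one_of_one_le₀ (hr y)) (inv_nonneg.2 (hr0 y).le)
          _ = (1 + ‖y‖)⁻¹ := mul_one _
      calc |‖U y‖ ^ 2 / 2 - P y| ≤ |‖U y‖ ^ 2 / 2| + |P y| := abs_sub _ _
        _ = ‖U y‖ ^ 2 / 2 + |P y| := by rw [abs_of_nonneg (by positivity)]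
        _ ≤ C * C * (1 + ‖y‖)⁻¹ / 2 + C * (1 + ‖y‖)⁻¹ := by gcongr; exact h1.trans h2; exact bP y
        _ = (C * C / 2 + C) * (1 + ‖y‖)⁻¹ := by ring
    calc ‖(‖U y‖ ^ 2 / 2 - P y) • curl U y‖ = |‖U y‖ ^ 2 / 2 - P y| * ‖curl U y‖ := by
          rw [norm_smul, Real.norm_eq_abs]
      _ ≤ ((C * C / 2 + C) * (1 + ‖y‖)⁻¹) * (κ * C * ((1 + ‖y‖) ^ 2)⁻¹) :=
          mul_le_mul hq (bΩ y) (norm_nonneg _) (by positivity)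
      _ = (C * C / 2 + C) * (κ * C) * ((1 + ‖y‖) ^ 3)⁻¹ := by
          field_simp [(hr0 y).ne']
  · calc ‖⟪U y, curl U y⟫ • U y‖ = |⟪U y, curl U y⟫| * ‖U y‖ := by
          rw [norm_smul, Real.norm_eq_abs]
      _ ≤ (‖U y‖ * ‖curl U y‖) * ‖U y‖ := by
          gcongr
          exact abs_real_inner_le_norm _ _
      _ ≤ ((C * (1 + ‖y‖)⁻¹) * (κ * C * ((1 + ‖y‖) ^ 2)⁻¹)) * (C * (1 + ‖y‖)⁻¹) :=
          mul_le_mul (mul_le_mul (bU y) (bΩ y) (norm_nonneg _) (by positivity)) (bU y)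
            (norm_nonneg _) (by positivity)
      _ = C * (κ * C) * C * ((1 + ‖y‖) ^ 4)⁻¹ := by
          field_simp [(hr0 y).ne']
      _ ≤ C * (κ * C) * C * ((1 + ‖y‖) ^ 3)⁻¹ :=
          hubbleHelicity_decay_mono (by positivity) (hr y) (by norm_num)
  · calc ‖cross (curl (curl U) y) (U y)‖ ≤ ‖curl (curl U) y‖ * ‖U y‖ :=
          norm_cross_le _ _
      _ ≤ (κ * C * ((1 + ‖y‖) ^ 3)⁻¹) * (C * (1 + ‖y‖)⁻¹) :=
          mul_le_mul (bΞ y) (bU y) (norm_nonneg _) (by positivity)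
      _ = κ * C * C * ((1 + ‖y‖) ^ 4)⁻¹ := by
          field_simp [(hr0 y).ne']
      _ ≤ κ * C * C * ((1 + ‖y‖) ^ 3)⁻¹ :=
          hubbleHelicity_decay_mono (by positivity) (hr y) (by norm_num)

/-- **The Ohmic density is integrable** in the decay class: `⟪Ω, curl Ω⟫ = O((1+|y|)⁻⁵) ∈ L¹(ℝ³)`
for `U ∈ C³`. -/
theorem hubbleHelicity_integrable_ohmic
    {U : EuclideanSpace ℝ (Fin 3) → EuclideanSpace ℝ (Fin 3)} (hU : ContDiff ℝ 3 U)
    {C : ℝ} (hC : ∀ y, ‖U y‖ ≤ C / (1 + ‖y‖) ∧ ‖fderiv ℝ U y‖ ≤ C / (1 + ‖y‖) ^ 2 ∧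
      ‖fderiv ℝ (curl U) y‖ ≤ C / (1 + ‖y‖) ^ 3) :
    Integrable (fun y => ⟪curl U y, curl (curl U) y⟫) := by
  have hU2 : ContDiff ℝ 2 U := hU.of_le (by norm_num)
  have hΩ2 : ContDiff ℝ 2 (curl U) := contDiff_curl (n := 2) (by exact_mod_cast hU)
  have hΩ1 : ContDiff ℝ 1 (curl U) := contDiff_curl (n := 1) (by exact_mod_cast hU2)
  have hΞ1 : ContDiff ℝ 1 (curl (curl U)) := contDiff_curl (n := 1) (by exact_mod_cast hΩ2)
  have hP0 : ∀ y : EuclideanSpace ℝ (Fin 3), |(fun _ => (0 : ℝ)) y| ≤ C / (1 + ‖y‖) := fun y => by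
    have h0 := (hC 0).1
    rw [norm_zero, add_zero, div_one] at h0
    simp only [abs_zero]
    exact div_nonneg ((norm_nonneg _).trans h0) (by positivity)
  exact hubbleDilution_integrable_of_le (K := (‖curlCLM‖ * C) * (‖curlCLM‖ * C)) (k := 5)
    (hΩ1.continuous.inner hΞ1.continuous) (by norm_num)
    fun y => (hubbleHelicity_decay_bounds hC hP0 y).1

end Summit.NavierStokesRegularity.NavierStokesRegularity.Theorems

end
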